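import Summits.BirchSwinnertonDyer.Rank1Residual.Partition.CornersCM
import Summits.BirchSwinnertonDyer.Rank1Residual.X12.CMDeuringTwo
import Literature.NumberTheory.EllipticCurves.IsogenyHasCMIffJMemProofs
import Literature.NumberTheory.EllipticCurves.OrdinaryPrimesProofs
import Literature.NumberTheory.EllipticCurves.SerreOpenImageOrdinaryInertiaProofs
import HarnessLib

/-!
# The CM corner `CornerF` is DECIDABLE from `(j, Δ_min, r, p)`: the §F corner predicate of
# RESIDUAL-MAP.md in arithmetic form (cell `b2b-bsdres`, seat rmap-3 gen 5; coordinator ruling (A)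
# 2026-08-20T22:2xZ "excluded corners are explicit, decidable predicates on (E, p)";
# RESIDUAL-MAP.md §F `CORNER PREDICATE — DECIDABILITY`, written in words by rmap-3 gen 3)

HONEST FRAMING (run/shared/lean/b2b/bsd-rank1-residual/, verbatim in every file): the goal of the
cell is to DELETE the COMBINATION-SHAPED residual classes of the Birch–Swinnerton-Dyer formula for
ALL analytic-rank `≤ 1` elliptic curves over `ℚ` — "full BSD formula for every rank `≤ 1` curve in
class `C`" assembled STRICTLY from published theorems — so that the rank-`≤ 1` remainder becomes
exactly the CONSTRUCTION-SHAPED classes, which are TYPED (missing-input `Prop`s), NOT attempted.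
This is not "finishing BSD". Theorems only: NO named fact is introduced, nothing about any
particular curve is asserted, no label of record changes.

What this file adds to `Partition/CornersCM.lean` (rmap-3 gen 2/3: `CornerF W p := W.HasCM ∧
W.analyticRank = 1 ∧ (p = 2 ∨ (¬ CMSplit W p ∧ ¬ Good W p))`, `bsdp_cm_of_not_cornerF`,
`cornerF_iff_of_ne_two`, `cornerFSharp_two_iff`): the SAME corner read on finite data of the pair.
Each atom is replaced by an arithmetic condition on the globally minimal model —
* `W.HasCM ↔ W.j ∈ cmJInvariants` (the thirteen rational CM `j`-invariants; tree THEOREM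
  `WeierstrassCurve.hasCM_iff_j_mem_holds`, Silverman *AEC* App. C §11),
* `Good W p ↔ ¬ p ∣ Δ_min(W)` (Silverman *AEC* VII.1 / VII.5; tree theorems
  `hasGoodReductionAtPrime_of_not_dvd`, `not_dvd_minimalDiscriminantInt_of_hasGoodReductionAtPrime'`),
* `CMSplit W p` is ALREADY arithmetic (`Rank1Residual/Predicates.lean`: `p ∤ d_K` and `d_K` a
  square mod `p`, resp. `d_K ≡ 1 (mod 8)` at `p = 2`, with `d_K = cmFieldDiscrOfJ W.j` read off
  the thirteen-value table),
* at `p = 2` the sharp corner's `¬ GoodOrd W 2` becomes `2 ∣ Δ_min ∨ d_K ≠ −7` by Deuring's criterion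
  at `2`, a kernel theorem of the lit-bst seat (`X12.goodOrd_two_iff_cmFieldDiscrOfJ_eq_neg_seven`,
  p247485) —
so that `cornerF_iff_arith` / `cornerF_iff_arith_of_ne_two` / `cornerFSharp_two_iff_arith` state
the §F corner as a predicate in `(W.j, Δ_min(W), W.analyticRank, p)` only. (The analytic rank is the
pair's datum `r ∈ {0, 1}`; every other atom is a finite computation — membership of `j` in a
13-element set, one integer divisibility, one Legendre symbol / residue mod 8.) The rmap-1 seat's
`Partition/CornersDecide.lean` does the same for the non-CM axes §A/§B/§C on the finite grid.

APPEND (gen 5, second landing): the corner AT `p = 3` on the table of CM fields —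
`not_cmSplit_three_iff` (`3` non-split ⟺ `d_K ∉ {−8, −11}`), `cornerF_three_iff_arith`
(`CornerF W 3` ⟺ `j ∈ cmJInvariants ∧ r = 1 ∧ 3 ∣ Δ_min ∧ d_K ∉ {−8, −11}`: RESIDUAL-MAP §S.3's
K12i@3 ∪ K12r@3 as four finite checks) and `cmRamified_three_iff_of_hasCM` (K12r@3 ⟺ `d_K = −3`).

APPEND (gen 5, third landing): the corner AT `p = 2` split by the behaviour of `2` in `K` —
`cmInert_two_iff_of_hasCM` (`2` inert ⟺ `d_K ∈ {−3, −11, −19, −43, −67, −163}`),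
`cmRamified_two_iff_of_hasCM` (`2` ramified ⟺ `d_K ∈ {−4, −8}`),
`cornerFSharp_two_iff_dvd_or_cmInert` (K12₂′ ⟺ `j ∈ cmJInvariants ∧ r = 1 ∧ (2 ∣ Δ_min ∨ 2 inert
in K)`: the ramified case is absorbed by `2 ∣ Δ_min`) and `cornerFSharp_two_iff_arith'` (the same
with the six discriminants spelled out).

APPEND (gen 5, fourth landing): the corner as a COMPUTABLE BOOLEAN FUNCTION of raw data —
`cmSplitData j p : Bool` (split test on the table value `d = cmFieldDiscrOfJ j`: `d % 8 = 1` at `2`,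
`p ∤ d ∧ ∃ x < p, p ∣ x² − d` at `p ≠ 2`), `cornerFData j Δ p : Bool`, with
`cmSplitData_eq_true_iff : cmSplitData W.j p = true ↔ CMSplit W p` and
`cornerF_iff_data : CornerF W p ↔ W.analyticRank = 1 ∧ cornerFData W.j (Δ_min W) p = true`; both
functions evaluate by `decide` (e.g. `cornerFData (−3375) (−343) 7 = true` — 49a1 at the ramified
`7` —, `cornerFData (−3375) (−343) 11 = false`, `cmSplitData 8000 3 = true`, `cmSplitData 1728 2 =
false`; examples kept out of the shipped file).

References: RESIDUAL-MAP.md §F (CORNER PREDICATE; DECIDABILITY ⟦rmap-3 g3⟧; AT A GLANCE ⟦g5⟧);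
`Partition/CornersCM.lean`; `X12/CMDeuringTwo.lean`; `Rank1Residual/Predicates.lean`.
-/

namespace Summit.BirchSwinnertonDyer.Rank1Residual

open WeierstrassCurve Literature.NumberTheory.EllipticCurves
  Literature.NumberTheory.EllipticCurves.Rank1Residual

section Curve

variable {W : WeierstrassCurve ℚ} [W.IsElliptic] [W.IsGloballyMinimal] {p : ℕ} [Fact p.Prime]

/-! ### The atoms in arithmetic form -/

omit [W.IsElliptic] in
/-- **Good reduction at `p` ⟺ `p ∤ Δ_min`** for a globally minimal model over `ℚ` (Silverman,
*AEC* VII.1 Remark 1.1 and VII.5 Prop. 5.1(a); both directions are tree theorems). [folklore] -/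
theorem good_iff_not_dvd_minimalDiscriminantInt :
    Good W p ↔ ¬ (p : ℤ) ∣ minimalDiscriminantInt W :=
  ⟨fun h ↦ W.not_dvd_minimalDiscriminantInt_of_hasGoodReductionAtPrime' p h,
    fun h ↦ hasGoodReductionAtPrime_of_not_dvd W p h⟩

omit [W.IsElliptic] in
/-- **Bad reduction at `p` ⟺ `p ∣ Δ_min`.** [folklore] -/
theorem not_good_iff_dvd_minimalDiscriminantInt :
    ¬ Good W p ↔ (p : ℤ) ∣ minimalDiscriminantInt W := by
  rw [good_iff_not_dvd_minimalDiscriminantInt, not_not]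

omit [W.IsGloballyMinimal] [Fact p.Prime] in
/-- **CM ⟺ `j` is one of the thirteen rational CM `j`-invariants** (Silverman, *AEC* App. C §11;
the tree theorem `WeierstrassCurve.hasCM_iff_j_mem_holds`). [folklore] -/
theorem hasCM_iff_j_mem_cmJInvariants : W.HasCM ↔ W.j ∈ cmJInvariants :=
  hasCM_iff_j_mem_holds W

omit [W.IsGloballyMinimal] in
/-- **`p` not split in the CM field, at an odd `p`, in arithmetic form**: `p ∣ d_K`, or `d_K` is
not a square mod `p` (`d_K = cmFieldDiscrOfJ W.j`). Pure unfolding of `CMSplit`. [folklore] -/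
theorem not_cmSplit_iff_of_ne_two (hp : p ≠ 2) :
    ¬ CMSplit W p ↔
      (p : ℤ) ∣ cmFieldDiscrOfJ W.j ∨ ¬ IsSquare ((cmFieldDiscrOfJ W.j : ℤ) : ZMod p) := by
  unfold CMSplit
  rw [if_neg hp, not_and_or, not_not]

omit [W.IsGloballyMinimal] in
/-- **`2` not split in the CM field, in arithmetic form**: `2 ∣ d_K` or `d_K ≢ 1 (mod 8)`.
Pure unfolding of `CMSplit` at `p = 2`. [folklore] -/
theorem not_cmSplit_two_iff :
    ¬ CMSplit W 2 ↔ (2 : ℤ) ∣ cmFieldDiscrOfJ W.j ∨ ¬ cmFieldDiscrOfJ W.j % 8 = 1 := by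
  unfold CMSplit
  rw [if_pos rfl, not_and_or, not_not]
  norm_cast

/-! ### The corner in arithmetic form -/

/-- **§F CORNER PREDICATE, DECIDABLE FORM (every prime).** `(W, p)` lies in the CM corner iff
`j(W)` is one of the thirteen CM `j`-invariants, the analytic rank is `1`, and either `p = 2` or
(`p` is not split in the CM field — an explicit Legendre / mod-8 condition on `d_K` — and
`p ∣ Δ_min`). [folklore] -/
theorem cornerF_iff_arith :
    CornerF W p ↔ W.j ∈ cmJInvariants ∧ W.analyticRank = 1 ∧
      (p = 2 ∨ (¬ CMSplit W p ∧ (p : ℤ) ∣ minimalDiscriminantInt W)) := by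
  rw [cornerF_iff, hasCM_iff_j_mem_cmJInvariants, not_good_iff_dvd_minimalDiscriminantInt]

/-- **§F CORNER PREDICATE, DECIDABLE FORM (odd prime).** For `p ≠ 2`: `CornerF W p` iff
`j(W) ∈ cmJInvariants`, `r = 1`, `p ∣ Δ_min(W)`, and (`p ∣ d_K` or `d_K` is a non-square mod `p`),
`d_K = cmFieldDiscrOfJ (j(W))` — the corner (K12i ∪ K12r at `p`) as four finite checks.
[folklore] -/
theorem cornerF_iff_arith_of_ne_two (hp : p ≠ 2) :
    CornerF W p ↔ W.j ∈ cmJInvariants ∧ W.analyticRank = 1 ∧ (p : ℤ) ∣ minimalDiscriminantInt W ∧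
      ((p : ℤ) ∣ cmFieldDiscrOfJ W.j ∨ ¬ IsSquare ((cmFieldDiscrOfJ W.j : ℤ) : ZMod p)) := by
  rw [cornerF_iff_of_ne_two hp, hasCM_iff_j_mem_cmJInvariants,
    not_good_iff_dvd_minimalDiscriminantInt, not_cmSplit_iff_of_ne_two hp]

omit [W.IsGloballyMinimal] [Fact p.Prime] in
/-- **The ramified disjunct K12r in arithmetic form**: inside the corner at an odd `p`, the
sub-corner "`p` ramified in `K`" is `p ∣ cmFieldDiscrOfJ (j(W))` (definition of `CMRamified`).
[folklore] -/
theorem cmRamified_iff_dvd_cmFieldDiscrOfJ : CMRamified W p ↔ (p : ℤ) ∣ cmFieldDiscrOfJ W.j :=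
  Iff.rfl

/-- **§F CORNER PREDICATE AT `p = 2`, DECIDABLE FORM.** The sharp corner `CornerF♯ W 2`
(CM, rank one, `2` not a prime of good ORDINARY reduction) iff `j(W) ∈ cmJInvariants`, `r = 1`,
and (`2 ∣ Δ_min(W)` or `d_K ≠ −7`) — by Deuring's criterion at `2` as a kernel theorem
(`X12.goodOrd_two_iff_cmFieldDiscrOfJ_eq_neg_seven`, lit-bst seat p247485: a CM curve good at `2`
is ordinary at `2` iff `K = ℚ(√−7)`). So K12₂′ = CM ∧ `r = 1` ∧ (`2 ∣ N` ∨ `K ≠ ℚ(√−7)`), read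
off `(j, Δ_min)`. [folklore] -/
theorem cornerFSharp_two_iff_arith :
    CornerFSharp W 2 ↔ W.j ∈ cmJInvariants ∧ W.analyticRank = 1 ∧
      ((2 : ℤ) ∣ minimalDiscriminantInt W ∨ cmFieldDiscrOfJ W.j ≠ -7) := by
  rw [cornerFSharp_two_iff, hasCM_iff_j_mem_cmJInvariants]
  refine ⟨fun ⟨hj, hr, hgo⟩ ↦ ⟨hj, hr, ?_⟩, fun ⟨hj, hr, h⟩ ↦ ⟨hj, hr, ?_⟩⟩
  · by_cases hg : Good W 2
    · right
      intro h7
      exact hgo ((X12.goodOrd_two_iff_cmFieldDiscrOfJ_eq_neg_seven W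
        ((hasCM_iff_j_mem_cmJInvariants (W := W)).2 hj) hg).2 h7)
    · left
      exact (not_good_iff_dvd_minimalDiscriminantInt (W := W) (p := 2)).1 hg
  · intro hgo
    rcases h with h2 | h7
    · exact (not_good_iff_dvd_minimalDiscriminantInt (W := W) (p := 2)).2 h2 hgo.1
    · exact h7 ((X12.goodOrd_two_iff_cmFieldDiscrOfJ_eq_neg_seven W
        ((hasCM_iff_j_mem_cmJInvariants (W := W)).2 hj) hgo.1).1 hgo)

/-! ### The corner at `p = 3` on the table of CM fields -/

omit [W.IsGloballyMinimal] in
/-- **`3` not split in the CM field ⟺ `d_K ∉ {−8, −11}`**, i.e. `K ∉ {ℚ(√−2), ℚ(√−11)}`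
(`d_K = −8 ⟺ j = 8000`, `d_K = −11 ⟺ j = −32768` on the table `cmFieldDiscrOfJ`): among the nine
class-number-one discriminants only `−8` and `−11` are prime to `3` and squares mod `3`. Both
directions are tree theorems (`BurungaleCastellaSkinnerTian2022.cmFieldDiscrOfJ_eq_of_cmSplit_three`
/ `cmSplit_three_of_cmFieldDiscrOfJ_eq`, Silverman *ATAEC* App. A §3). [folklore] -/
theorem not_cmSplit_three_iff :
    ¬ CMSplit W 3 ↔ cmFieldDiscrOfJ W.j ≠ -8 ∧ cmFieldDiscrOfJ W.j ≠ -11 := by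
  rw [← not_or, not_iff_not]
  exact ⟨BurungaleCastellaSkinnerTian2022.cmFieldDiscrOfJ_eq_of_cmSplit_three W,
    BurungaleCastellaSkinnerTian2022.cmSplit_three_of_cmFieldDiscrOfJ_eq W⟩

/-- **§F / §S.3 CORNER AT `p = 3`, DECIDABLE FORM.** `CornerF W 3` (the CM corner at `3` =
K12i@3 ∪ K12r@3 of RESIDUAL-MAP §S.3) iff `j(W) ∈ cmJInvariants`, `r = 1`, `3 ∣ Δ_min(W)`, and
`d_K ∉ {−8, −11}` — CM, rank one, BAD at `3`, and `K` is neither `ℚ(√−2)` nor `ℚ(√−11)` (the two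
CM fields in which `3` splits; in `K = ℚ(√−3)` it ramifies — K12r@3 —, in the other six it is
inert — K12i@3; RESIDUAL-MAP §S.1). [folklore] -/
theorem cornerF_three_iff_arith :
    CornerF W 3 ↔ W.j ∈ cmJInvariants ∧ W.analyticRank = 1 ∧ (3 : ℤ) ∣ minimalDiscriminantInt W ∧
      cmFieldDiscrOfJ W.j ≠ -8 ∧ cmFieldDiscrOfJ W.j ≠ -11 := by
  rw [cornerF_iff_of_ne_two (show (3 : ℕ) ≠ 2 by decide), hasCM_iff_j_mem_cmJInvariants,
    not_good_iff_dvd_minimalDiscriminantInt, not_cmSplit_three_iff, Nat.cast_ofNat]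

omit [W.IsGloballyMinimal] in
/-- **The two sub-corners at `3` in decidable form**: inside `CornerF W 3`, the pair is K12r@3
(`3` ramified in `K`) iff `d_K = −3` (`j ∈ {0, 54000, −12288000}`), and K12i@3 (`3` inert in `K`)
otherwise, i.e. `d_K ∈ {−4, −7, −19, −43, −67, −163}`. Here: `CMRamified W 3 ↔ d_K = −3` for a CM
curve (`d_K ≠ 0`). [folklore] -/
theorem cmRamified_three_iff_of_hasCM (hcm : W.HasCM) :
    CMRamified W 3 ↔ cmFieldDiscrOfJ W.j = -3 := by
  have h0 : cmFieldDiscrOfJ W.j ≠ 0 := X12.cmFieldDiscrOfJ_ne_zero_of_hasCM W hcm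
  unfold CMRamified
  rcases BurungaleCastellaSkinnerTian2022.cmFieldDiscrOfJ_cases W.j with
      hd | hd | hd | hd | hd | hd | hd | hd | hd | hd <;>
    rw [hd] at h0 ⊢ <;> revert h0 <;> decide

/-! ### The corner at `p = 2` split by the behaviour of `2` in `K` -/

omit [W.IsGloballyMinimal] in
/-- **`2` inert in the CM field ⟺ `d_K ∈ {−3, −11, −19, −43, −67, −163}`** (`d_K ≡ 5 (mod 8)`) for a
CM curve; `2` ramifies iff `d_K ∈ {−4, −8}` and splits iff `d_K = −7` (Silverman *ATAEC* App. A §3;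
pure table reading). [folklore] -/
theorem cmInert_two_iff_of_hasCM (hcm : W.HasCM) :
    CMInert W 2 ↔ cmFieldDiscrOfJ W.j = -3 ∨ cmFieldDiscrOfJ W.j = -11 ∨ cmFieldDiscrOfJ W.j = -19 ∨
      cmFieldDiscrOfJ W.j = -43 ∨ cmFieldDiscrOfJ W.j = -67 ∨ cmFieldDiscrOfJ W.j = -163 := by
  have h0 : cmFieldDiscrOfJ W.j ≠ 0 := X12.cmFieldDiscrOfJ_ne_zero_of_hasCM W hcm
  unfold CMInert CMRamified CMSplit
  rw [if_pos rfl]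
  rcases BurungaleCastellaSkinnerTian2022.cmFieldDiscrOfJ_cases W.j with
      hd | hd | hd | hd | hd | hd | hd | hd | hd | hd <;>
    rw [hd] at h0 ⊢ <;> revert h0 <;> decide

omit [W.IsGloballyMinimal] in
/-- **`2` ramified in the CM field ⟺ `d_K ∈ {−4, −8}`** (`K ∈ {ℚ(i), ℚ(√−2)}`,
`j ∈ {1728, 287496, 8000}`). [folklore] -/
theorem cmRamified_two_iff_of_hasCM (hcm : W.HasCM) :
    CMRamified W 2 ↔ cmFieldDiscrOfJ W.j = -4 ∨ cmFieldDiscrOfJ W.j = -8 := by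
  have h0 : cmFieldDiscrOfJ W.j ≠ 0 := X12.cmFieldDiscrOfJ_ne_zero_of_hasCM W hcm
  unfold CMRamified
  rcases BurungaleCastellaSkinnerTian2022.cmFieldDiscrOfJ_cases W.j with
      hd | hd | hd | hd | hd | hd | hd | hd | hd | hd <;>
    rw [hd] at h0 ⊢ <;> revert h0 <;> decide

/-- **K12₂′ = (`2 ∣ N`) ⊔ (`2` good and INERT in `K`)**: the sharp corner at `2` iff
`j ∈ cmJInvariants`, `r = 1`, and (`2 ∣ Δ_min` or `2` is inert in `K`). The ramified case
(`K ∈ {ℚ(i), ℚ(√−2)}`) needs no separate disjunct: `2` ramified in `K` forces bad reduction at `2`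
(lit-bst's `X12.not_good_two_of_cmRamified_two`), and at a good `2` "not ordinary" = supersingular =
inert (Deuring at `2`, `X12.goodSS_two_iff_cmInert_two`). RESIDUAL-MAP §S.4 'K12₂′ (2 ∣ N, or 2
inert / ramified in K)'. [folklore] -/
theorem cornerFSharp_two_iff_dvd_or_cmInert :
    CornerFSharp W 2 ↔ W.j ∈ cmJInvariants ∧ W.analyticRank = 1 ∧
      ((2 : ℤ) ∣ minimalDiscriminantInt W ∨ CMInert W 2) := by
  rw [cornerFSharp_two_iff, hasCM_iff_j_mem_cmJInvariants]
  refine ⟨fun ⟨hj, hr, hgo⟩ ↦ ⟨hj, hr, ?_⟩, fun ⟨hj, hr, h⟩ ↦ ⟨hj, hr, ?_⟩⟩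
  · have hcm : W.HasCM := (hasCM_iff_j_mem_cmJInvariants (W := W)).2 hj
    by_cases hg : Good W 2
    · right
      refine (X12.goodSS_two_iff_cmInert_two W hcm hg).1 ⟨hg, ?_⟩
      by_contra ha
      exact hgo ⟨hg, ha⟩
    · exact Or.inl ((not_good_iff_dvd_minimalDiscriminantInt (W := W) (p := 2)).1 hg)
  · have hcm : W.HasCM := (hasCM_iff_j_mem_cmJInvariants (W := W)).2 hj
    intro hgo
    rcases h with h2 | hin
    · exact (not_good_iff_dvd_minimalDiscriminantInt (W := W) (p := 2)).2 h2 hgo.1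
    · exact hgo.2 ((X12.goodSS_two_iff_cmInert_two W hcm hgo.1).2 hin).2

/-- **§F / §S.4 CORNER AT `p = 2`, DECIDABLE FORM, SPLIT BY `K`**: `CornerFSharp W 2` iff
`j ∈ cmJInvariants`, `r = 1`, and (`2 ∣ Δ_min(W)` or `d_K ∈ {−3, −11, −19, −43, −67, −163}`) — CM,
rank one, and either `2` is bad, or `2` is good and `K` is one of the six fields in which `2` is
inert. [folklore] -/
theorem cornerFSharp_two_iff_arith' :
    CornerFSharp W 2 ↔ W.j ∈ cmJInvariants ∧ W.analyticRank = 1 ∧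
      ((2 : ℤ) ∣ minimalDiscriminantInt W ∨ (cmFieldDiscrOfJ W.j = -3 ∨ cmFieldDiscrOfJ W.j = -11 ∨
        cmFieldDiscrOfJ W.j = -19 ∨ cmFieldDiscrOfJ W.j = -43 ∨ cmFieldDiscrOfJ W.j = -67 ∨
        cmFieldDiscrOfJ W.j = -163)) := by
  rw [cornerFSharp_two_iff_dvd_or_cmInert]
  constructor
  · rintro ⟨hj, hr, h⟩
    refine ⟨hj, hr, h.imp_right fun hin ↦ ?_⟩
    exact (cmInert_two_iff_of_hasCM ((hasCM_iff_j_mem_cmJInvariants (W := W)).2 hj)).1 hin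
  · rintro ⟨hj, hr, h⟩
    refine ⟨hj, hr, h.imp_right fun hd ↦ ?_⟩
    exact (cmInert_two_iff_of_hasCM ((hasCM_iff_j_mem_cmJInvariants (W := W)).2 hj)).2 hd


/-! ### The corner as a BOOLEAN FUNCTION of the raw data `(j, Δ_min, p)` -/

/-- **`p` split in the CM field, as a Boolean on raw data**: with `d = cmFieldDiscrOfJ j`, at `p = 2`
the test is `d % 8 = 1`; at `p ≠ 2` it is `p ∤ d` and `x² ≡ d (mod p)` for some `0 ≤ x < p` (a
finite search, so that `decide` evaluates it; for a prime `p` this is "`p` unramified and `d` a square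
mod `p`"). Computable. [folklore] -/
def cmSplitData (j : ℚ) (p : ℕ) : Bool :=
  if p = 2 then decide (cmFieldDiscrOfJ j % 8 = 1)
  else !decide ((p : ℤ) ∣ cmFieldDiscrOfJ j) &&
    (List.range p).any fun x => decide ((p : ℤ) ∣ (x : ℤ) * x - cmFieldDiscrOfJ j)

/-- **The CM corner as a Boolean on raw data** `(j, Δ, p)` (the pair's rank datum `r = 1` is kept
apart): `j ∈ cmJInvariants` and (`p = 2`, or `p` is not split in `K` and `p ∣ Δ`). Computable.
[folklore] -/
def cornerFData (j : ℚ) (Δ : ℤ) (p : ℕ) : Bool :=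
  decide (j ∈ cmJInvariants) && (decide (p = 2) || (!cmSplitData j p && decide ((p : ℤ) ∣ Δ)))

omit [W.IsGloballyMinimal] in
/-- The Boolean split test agrees with `CMSplit` at every prime. [folklore] -/
theorem cmSplitData_eq_true_iff : cmSplitData W.j p = true ↔ CMSplit W p := by
  unfold cmSplitData CMSplit
  by_cases hp : p = 2
  · rw [if_pos hp, if_pos hp]
    subst hp
    simp only [decide_eq_true_eq, Nat.cast_ofNat]
    constructor
    · intro h
      refine ⟨?_, h⟩
      intro h2
      omega
    · exact fun h ↦ h.2
  · simp only [if_neg hp, Bool.and_eq_true, Bool.not_eq_true', decide_eq_false_iff_not,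
      List.any_eq_true, List.mem_range, decide_eq_true_eq]
    refine and_congr_right fun _ ↦ ⟨?_, ?_⟩
    · rintro ⟨x, -, hx⟩
      refine ⟨(x : ZMod p), ?_⟩
      have h0 := (ZMod.intCast_zmod_eq_zero_iff_dvd _ p).2 hx
      push_cast at h0
      linear_combination -h0
    · rintro ⟨r, hr⟩
      haveI : NeZero p := ⟨(Fact.out : p.Prime).ne_zero⟩
      refine ⟨r.val, r.val_lt, (ZMod.intCast_zmod_eq_zero_iff_dvd _ p).1 ?_⟩
      push_cast
      rw [ZMod.natCast_zmod_val, hr, sub_self]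

/-- **§F CORNER PREDICATE AS A BOOLEAN FUNCTION ON `(j, Δ_min, p)` plus the rank datum**:
`CornerF W p ↔ W.analyticRank = 1 ∧ cornerFData (j W) (Δ_min W) p = true` — the literal form of
"the excluded corner is an explicit, decidable predicate on (E, p)" (coordinator ruling (A)) on
the CM axis: `cornerFData` is a computable Boolean function of two integers-worth of curve data and
the prime. [folklore] -/
theorem cornerF_iff_data :
    CornerF W p ↔ W.analyticRank = 1 ∧ cornerFData W.j (minimalDiscriminantInt W) p = true := by
  have hs : (!cmSplitData W.j p) = true ↔ ¬ CMSplit W p := by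
    rw [← cmSplitData_eq_true_iff (W := W) (p := p)]
    cases cmSplitData W.j p <;> simp
  rw [cornerF_iff_arith]
  simp only [cornerFData, Bool.and_eq_true, Bool.or_eq_true, decide_eq_true_eq, hs]
  tauto

/-- **Outside the arithmetic corner, `BSD(E, p)` for CM curves** — `bsdp_cm_of_not_cornerF`
restated with the corner in decidable form: for `W/ℚ` globally minimal with `j(W) ∈ cmJInvariants`
and analytic rank `≤ 1`, granted the four named CM facts, `BSD(E, p)` holds unless `r = 1` and
(`p = 2`, or `p ∣ Δ_min` with `p` not split in `K`). [folklore] -/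
theorem bsdp_cm_of_not_cornerF_arith (hCM : bsdTriple_of_hasCM_of_L_one_ne_zero)
    (hmod : hasEntireLFunction_rat) (hLLT : LiLiuTian2024.thm11_bsdp_of_cm_rank_one)
    (hKob : Kobayashi2013.cor14_bsdp_of_cm_rank_one)
    (hj : W.j ∈ cmJInvariants) (hr : W.analyticRank ≤ 1)
    (hF : ¬ (W.analyticRank = 1 ∧ (p = 2 ∨ (¬ CMSplit W p ∧ (p : ℤ) ∣ minimalDiscriminantInt W)))) :
    BSDp W p := by
  have hcm : W.HasCM := (hasCM_iff_j_mem_cmJInvariants (W := W)).2 hj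
  refine bsdp_cm_of_not_cornerF hCM hmod hLLT hKob hcm hr ?_
  intro hc
  exact hF ((cornerF_iff_arith (W := W) (p := p)).1 hc).2

end Curve

end Summit.BirchSwinnertonDyer.Rank1Residual
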